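import Summits.NavierStokesRegularity.NavierStokesRegularity.Theorems.ScenarioCensusRowF1ax
import Summits.NavierStokesRegularity.NavierStokesRegularity.Theorems.ScenarioCensusRowA7h
import Summits.NavierStokesRegularity.NavierStokesRegularity.Theorems.DssFarFieldSlavingBlowupTypeIDssProfileSimilarityEnstrophyBeltramiLiouville
import Summits.NavierStokesRegularity.NavierStokesRegularity.Theorems.SqueezeCycleSingularZoomWindow
import Summits.NavierStokesRegularity.NavierStokesRegularity.Theorems.ClockStretchingLawClockCeilingZoomDerivLimit
import Summits.NavierStokesRegularity.NavierStokesRegularity.Theorems.PoloidalWindowDoorPoloidalWindowRigidityVorticityTranslate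
import Literature.Analysis.FluidPDE.TypeIAncientMild
import Literature.Analysis.FluidPDE.WholeSpaceIBP
import Literature.Analysis.FluidPDE.ClassicalSolutionCalculus
import Literature.Analysis.FluidPDE.VorticityEquation
import Literature.Analysis.FluidPDE.TypeIAncientMildClassical
import HarnessLib
import Summits.NavierStokesRegularity.NavierStokesRegularity.Theorems.ScenarioCensusRowF1FrozenTop

/-!
# Census row F1, family «DYNAMIC TOP / one-sided Lagrangian», integrated sub-family (F1ip ⊇ F1ipb; floors DIVERGENT PRODUCTION / DIVERGENT EXCESS) — LINE
# «integrated-stretch» port, part 1/5: levels, the sharp Type-I constant, the third-order datum and the read-out `stretchOf` (§1); calculus of zooms up to third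
# order with the `C²_loc` / `C³_loc` tools (§2; the lemmas shared verbatim with the landed inviscid-top / frozen-top ports are taken BY NAME)

Re-homed for the scenario census (typer seat ns-census-typer-1 g8; the cells F1ip / F1ipb and the floors DP / DX are MEMBERS OF RECORD «DECIDED IN KERNEL IN FILES» of
row F1 since census v1.76 (critic idea-crit-3 g7 PASS — no price 01:59:32Z; ref ns-census-ref g10 PRE-CHECK ✓ §15.8–10; lead-presearch label); this port makes them
TREE-decided): VERBATIM PORT of ns-idea-3 LINE 23 «integrated-stretch», `pub/ideators/ns-idea-3/lines/integrated-stretch/line-integrated-stretch.lean` sha16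
1cd526fed4663244 (1567 l., lean check rc 0, 0 sorry), split for the 400-line rule into `ScenarioCensusRowF1IntStretch` (§1–§2) → `…IntStretchZoom` (§3–§5a) →
`…IntStretchTransfer` (§5b) → `…IntStretchKill` (§6–§7) → `…IntStretchBudget` (§8 + census KEYS).  Lean text VERBATIM in namespace
`…Theorems.ScenarioCensus.IntegratedStretch` (the line's `…Cruxes.ScenarioCensusRowF1.IntegratedStretchLine` re-homed); port edits: the bracket lines `section
IntegralTransfer` / `end IntegralTransfer` dropped (no `variable`s; the section spans two parts), `@[conjecture]` on the residual `IpSlack` (≡ `ScenarioCensus.Row_F1`,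
OPEN), four one-line docstrings added (gate lint); lemmas the line shares VERBATIM with the landed inviscid-top / frozen-top / columnar-top / stretched-top ports are
taken BY NAME (listed below).  Statements untouched.

No census VALUE is moved here (row F1 stays OPEN-WITH-LINE; the members become TREE-decided by name); NS regularity is NOT proved; `Row_F1` is untouched
(zero movement, `ipSlack_iff_rowF1`); no summit statement is proved by this file. Lemmas that restate already-landed tree declarations are taken BY NAME (gate lint `dedup.landed`): `fderiv_smul_stPull_apply` = `InviscidTop.fderiv_smul_stPull_apply`, `fderiv_smul_stPull` = `InviscidTop.fderiv_smul_stPull`, `fderiv_fderiv_smul_stPull` = `InviscidTop.fderiv_fderiv_smul_stPull`, `tendsto_clm_of_tendsto_apply` = `InviscidTop.tendsto_clm_of_tendsto_apply`, `tendsto_fderiv_fderiv_apply_of_bound` = `InviscidTop.tendsto_fderiv_fderiv_apply_of_bound`, `tendsto_fderiv_fderiv_of_bound` = `InviscidTop.tendsto_fderiv_fderiv_of_bound`, `tendsto_fderiv_fderiv_of_typeI_seq_Ioo` = `InviscidTop.tendsto_fderiv_fderiv_of_typeI_seq_Ioo`, `sing_of_not_bounded` = `InviscidTop.sing_of_not_bounded`,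 `convect_curl_self` = `FrozenTop.convect_curl_self`, `fderiv3_smul_stPull` = `FrozenTop.fderiv3_smul_stPull`, `tendsto_fderiv3_of_typeI_seq_Ioo` = `FrozenTop.tendsto_fderiv3_of_typeI_seq_Ioo`, `radius_eq` = `FrozenTop.radius_eq`, `jointCond_everywhere₆` = `FrozenTop.jointCond_everywhere₄`, `tendsto_physicalTime` = `ColumnarTop.tendsto_physicalTime`, `eventually_fast` = `ColumnarTop.eventually_fast`, `sqrt_timeLag` = `StretchedTop.sqrt_timeLag`, `forall_of_forall_ne_zero` = `StretchedTop.forall_of_forall_ne_zero`, `cert_ineq_of_stretching` = `StretchedTop.cert_ineq_of_stretching`, `typeI_ancient_eq_zero_of_subcriticalStretching` = `StretchedTop.typeI_ancient_eq_zero_of_subcriticalStretching`.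
-/

-- the summit and its single problem share the name `NavierStokesRegularity` (D-0017 nested layout)
set_option linter.dupNamespace false

noncomputable section

open MeasureTheory Set Function Filter TopologicalSpace Metric
open scoped Topology NNReal ENNReal InnerProductSpace RealInnerProductSpace Laplacian

namespace Summit.NavierStokesRegularity.NavierStokesRegularity.Theorems.ScenarioCensus.IntegratedStretch

open Literature.Analysis Literature.Analysis.FluidPDE
open Summit.NavierStokesRegularity.NavierStokesRegularity.Theorems

/-- `ℝ³`. -/
abbrev E3 := EuclideanSpace ℝ (Fin 3)

/-- The space of Hessians `D²v(x) : ℝ³ →L (ℝ³ →L ℝ³)`. -/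
abbrev Hess := E3 →L[ℝ] E3 →L[ℝ] E3

/-- The coordinate unit vectors. -/
abbrev eI (i : Fin 3) : E3 := EuclideanSpace.single i (1 : ℝ)

/-! ## §1 Levels, the sharp Type-I constant; the third-order datum `K = Σᵢ D³v(eᵢ,eᵢ,·)` (kept for the joint weight-6
engine) and the weight-6 PRODUCTION read-out `𝓟 = ⟪ω, (ω·∇)v⟫ = ⟪ω, S ω⟫` (purely kinematic) -/

/-- **Subcritical (moving) speed level**: `Λ(t) √(T − t) → 0` as `t ↑ T`. -/
def IsSubcriticalLevel (T : ℝ) (Λ : ℝ → ℝ) : Prop :=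
  Tendsto (fun t => Λ t * Real.sqrt (T - t)) (𝓝[<] T) (𝓝 0)

/-- **Type-I blow-up with dimensionless constant `M`**: eventually `√(T − t) ‖u(t, x)‖ ≤ M √ν`. -/
def IsTypeIBlowupWith (M ν : ℝ) (u : ℝ → E3 → E3) (T : ℝ) : Prop :=
  ∀ᶠ t in 𝓝[<] T, ∀ x : E3, Real.sqrt (T - t) * ‖u t x‖ ≤ M * Real.sqrt ν

/-- **Third-order datum**: the trace `Σᵢ D³v(x) eᵢ eᵢ ∈ L(ℝ³)` of the third derivative in its two outer slots. -/
def lapD (v : E3 → E3) (x : E3) : E3 →L[ℝ] E3 := ∑ i, fderiv ℝ (fderiv ℝ (fderiv ℝ v)) x (eI i) (eI i)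

/-- **Production (vortex-stretching) read-out** of (value, gradient, Hessian, third-order datum): the scalar
`⟪curl L, L (curl L)⟫` — at `x`, with `L = ∇v(x)`, this is `⟪ω, (ω·∇)v⟫(x) = ⟪ω, ∇v ω⟫ = ⟪ω, S ω⟫` (the antisymmetric
part of `∇v` drops out): the ENSTROPHY-PRODUCTION DENSITY.  It depends only on `L`; the other slots are kept so that the
joint weight-6 transfer `integral_transfer₆` applies unchanged. -/
def stretchOf (_v : E3) (L : E3 →L[ℝ] E3) (_H : Hess) (_K : E3 →L[ℝ] E3) : ℝ :=
  ⟪curlCLM L, L (curlCLM L)⟫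

/-- Weight-6 homogeneity under the `𝒦`-scaling `(v, L, H, K) ↦ (a v, a² L, a³ H, a⁴ K)`. -/
theorem stretchOf_smul {a : ℝ} (v : E3) (L : E3 →L[ℝ] E3) (H : Hess) (K : E3 →L[ℝ] E3) :
    stretchOf (a • v) (a ^ 2 • L) (a ^ 3 • H) (a ^ 4 • K) = a ^ 6 * stretchOf v L H K := by
  simp only [stretchOf, _root_.smul_apply, ContinuousLinearMap.map_smul, smul_smul,
    real_inner_smul_left, real_inner_smul_right]
  ring

/-- The read-out `stretchOf` is continuous. -/
theorem continuous_stretchOf :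
    Continuous fun q : E3 × (E3 →L[ℝ] E3) × Hess × (E3 →L[ℝ] E3) => stretchOf q.1 q.2.1 q.2.2.1 q.2.2.2 := by
  have hc : Continuous (curlCLM : (E3 →L[ℝ] E3) →L[ℝ] E3) := curlCLM.continuous
  have hL : Continuous fun q : E3 × (E3 →L[ℝ] E3) × Hess × (E3 →L[ℝ] E3) => curlCLM q.2.1 :=
    hc.comp continuous_snd.fst
  have h3 : Continuous fun q : E3 × (E3 →L[ℝ] E3) × Hess × (E3 →L[ℝ] E3) => q.2.1 (curlCLM q.2.1) :=
    continuous_snd.fst.clm_apply hL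
  exact hL.inner h3

/-- `stretchOf` vanishes at the zero datum. -/
theorem stretchOf_zero : stretchOf 0 0 0 0 = 0 := by simp [stretchOf]

-- `convect_curl_self`: the line restates the tree's `FrozenTop.convect_curl_self`; taken BY NAME (gate lint dedup.landed).

/-- `curl v (x) = curl (Dv(x))` (definitional). -/
theorem curl_apply_eq (v : E3 → E3) (x : E3) : curl v x = curlCLM (fderiv ℝ v x) := rfl

/-- `⟪ω, (ω·∇)v⟫(x)` is the read-out `stretchOf` of `(v, ∇v, ∇²v, Σᵢ D³v eᵢ eᵢ)(x)` (every field: both sides use the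
same `fderiv`). -/
theorem stretch_eq (v : E3 → E3) (x : E3) :
    ⟪curl v x, convect (curl v) v x⟫ = stretchOf (v x) (fderiv ℝ v x) (fderiv ℝ (fderiv ℝ v) x) (lapD v x) := by
  rw [stretchOf, FrozenTop.convect_curl_self, curl_apply_eq]

/-- The same number in the «`⟪∇v ω, ω⟫`» convention of the tree's stretching certificates. -/
theorem stretch_eq' (v : E3 → E3) (x : E3) :
    ⟪fderiv ℝ v x (curl v x), curl v x⟫ = stretchOf (v x) (fderiv ℝ v x) (fderiv ℝ (fderiv ℝ v) x) (lapD v x) := by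
  rw [← stretch_eq, FrozenTop.convect_curl_self, curl_apply_eq, real_inner_comm]

/-- `ν`-normalisation: `ν³ w · stretchOf(u/ν, ∇u/ν, ∇²u/ν, K/ν) = w ⟪ω, (ω·∇)u⟫`. -/
theorem nu_readout_stretchOf {ν : ℝ} (hν : 0 < ν) (w : ℝ) (v : E3 → E3) (x : E3) :
    ν ^ 3 * w * stretchOf (ν⁻¹ • v x) (ν⁻¹ • fderiv ℝ v x) (ν⁻¹ • fderiv ℝ (fderiv ℝ v) x) (ν⁻¹ • lapD v x) =
      w * ⟪curl v x, convect (curl v) v x⟫ := by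
  rw [FrozenTop.convect_curl_self, curl_apply_eq]
  simp only [stretchOf, _root_.smul_apply, ContinuousLinearMap.map_smul, smul_smul,
    real_inner_smul_left, real_inner_smul_right]
  field_simp
/-! ### Constant levels; the sharp Type-I constant of a Type-I blow-up -/

/-- Constant levels are subcritical. -/
theorem isSubcriticalLevel_const (T Λ : ℝ) : IsSubcriticalLevel T (fun _ => Λ) := by
  have h : Tendsto (fun t : ℝ => Λ * Real.sqrt (T - t)) (𝓝 T) (𝓝 (Λ * Real.sqrt (T - T))) :=
    ((continuous_const.sub continuous_id).sqrt.tendsto T).const_mul Λ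
  rw [sub_self, Real.sqrt_zero, mul_zero] at h
  exact h.mono_left nhdsWithin_le_nhds

/-- A dimensionless Type-I bound is a Type-I bound. -/
theorem IsTypeIBlowupWith.isTypeIBlowup {M ν T : ℝ} {u : ℝ → E3 → E3} (h : IsTypeIBlowupWith M ν u T) :
    IsTypeIBlowup u T := by
  refine ⟨M * Real.sqrt ν, ?_⟩
  filter_upwards [h, self_mem_nhdsWithin] with t ht htT x
  have htT' : t < T := htT
  have hs : 0 < Real.sqrt (T - t) := Real.sqrt_pos.2 (sub_pos.2 htT')
  rw [le_div_iff₀ hs, mul_comm]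
  exact ht x

/-- Every Type-I blow-up has a dimensionless constant (`M = C/√ν`). -/
theorem exists_isTypeIBlowupWith {ν T : ℝ} (hν : 0 < ν) {u : ℝ → E3 → E3} (h : IsTypeIBlowup u T) :
    ∃ M : ℝ, IsTypeIBlowupWith M ν u T := by
  obtain ⟨C, hC⟩ := h
  refine ⟨C / Real.sqrt ν, ?_⟩
  have hsν : 0 < Real.sqrt ν := Real.sqrt_pos.2 hν
  filter_upwards [hC, self_mem_nhdsWithin] with t ht htT x
  have htT' : t < T := htT
  have hs : 0 < Real.sqrt (T - t) := Real.sqrt_pos.2 (sub_pos.2 htT')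
  rw [div_mul_cancel₀ C hsν.ne']
  have h1 := ht x
  rw [le_div_iff₀ hs] at h1
  rw [mul_comm]
  exact h1

/-! ## §2 Calculus of zooms up to third order; the `C²_loc` tool (LINE 18) and the `C³_loc` tool (LINE 20), re-proved verbatim -/

-- `fderiv_smul_stPull_apply`: the line restates the tree's `InviscidTop.fderiv_smul_stPull_apply`; taken BY NAME (gate lint dedup.landed).

-- `fderiv_smul_stPull`: the line restates the tree's `InviscidTop.fderiv_smul_stPull`; taken BY NAME (gate lint dedup.landed).

-- `fderiv_fderiv_smul_stPull`: the line restates the tree's `InviscidTop.fderiv_fderiv_smul_stPull`; taken BY NAME (gate lint dedup.landed).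

-- `fderiv3_smul_stPull`: the line restates the tree's `FrozenTop.fderiv3_smul_stPull`; taken BY NAME (gate lint dedup.landed).

/-- The third-order datum of a rescaled field. -/
theorem lapD_smul_stPull (a β γ t₀ : ℝ) (x₀ : E3) (ψ : ℝ → E3 → E3) (s : ℝ) (y : E3) :
    lapD ((a • stPull β γ t₀ x₀ ψ) s) y = (a * γ * γ * γ) • lapD (ψ (t₀ + β * s)) (x₀ + γ • y) := by
  simp only [lapD, FrozenTop.fderiv3_smul_stPull, _root_.smul_apply, Finset.smul_sum]

-- `tendsto_clm_of_tendsto_apply`: the line restates the tree's `InviscidTop.tendsto_clm_of_tendsto_apply`; taken BY NAME (gate lint dedup.landed).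

-- `tendsto_fderiv_fderiv_apply_of_bound`: the line restates the tree's `InviscidTop.tendsto_fderiv_fderiv_apply_of_bound`; taken BY NAME (gate lint dedup.landed).

-- `tendsto_fderiv_fderiv_of_bound`: the line restates the tree's `InviscidTop.tendsto_fderiv_fderiv_of_bound`; taken BY NAME (gate lint dedup.landed).

/-! ### Hessian (`C²_loc`) convergence of Type-I mild sequences (LINE 18's extraction tool) -/

-- `tendsto_fderiv_fderiv_of_typeI_seq_Ioo`: the line restates the tree's `InviscidTop.tendsto_fderiv_fderiv_of_typeI_seq_Ioo`; taken BY NAME (gate lint dedup.landed).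

/-! ### Third-order (`C³_loc`) convergence of Type-I mild sequences (LINE 20's extraction tool) -/

-- `tendsto_fderiv3_of_typeI_seq_Ioo`: the line restates the tree's `FrozenTop.tendsto_fderiv3_of_typeI_seq_Ioo`; taken BY NAME (gate lint dedup.landed).

/-- **Convergence of the third-order data** `Σᵢ D³wₖ(t)(x) eᵢ eᵢ → Σᵢ D³W(t)(x) eᵢ eᵢ`. -/
theorem tendsto_lapD_of_typeI_seq_Ioo {C C' : ℝ} {A : ℕ → ℝ} (hA : Tendsto A atTop atBot)
    {w : ℕ → ℝ → E3 → E3}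
    (hc : ∀ k, ContinuousOn (uncurry (w k)) (Ioo (A k) 0 ×ˢ univ))
    (hdivw : ∀ k, ∀ t ∈ Ioo (A k) 0, IsWeaklyDivFree (w k t))
    (hmild : ∀ k, ∀ s t : ℝ, A k < s → s < t → t < 0 → ∀ x,
      w k t x = UnboundedOperators.heatExtension (w k s) (t - s) x - oseenDuhamel 1 s (w k) (w k) t x)
    (hI : ∀ k, ∀ t ∈ Ioo (A k) 0, ∀ x, ‖w k t x‖ ≤ C / Real.sqrt (-t))
    {W : ℝ → E3 → E3} (hW : IsTypeIAncientMild C' W)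
    (hgrad : ∀ t < 0, ∀ x, Tendsto (fun k => fderiv ℝ (w k t) x) atTop (𝓝 (fderiv ℝ (W t) x))) :
    ∀ t < 0, ∀ x, Tendsto (fun k => lapD (w k t) x) atTop (𝓝 (lapD (W t) x)) := by
  intro t ht x
  unfold lapD
  refine tendsto_finsetSum _ fun i _ => ?_
  exact ((ContinuousLinearMap.apply ℝ (E3 →L[ℝ] E3) (eI i)).continuous.tendsto _).comp
    (FrozenTop.tendsto_fderiv3_of_typeI_seq_Ioo hA hc hdivw hmild hI hW hgrad t ht x (eI i))

end Summit.NavierStokesRegularity.NavierStokesRegularity.Theorems.ScenarioCensus.IntegratedStretch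

end
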